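import Summits.ABC.IUTFork.Thm311RealInd1StripPacketThetaJunctionVolume
import Literature.IUT.LogVolume.RescaledCompletionInvariants
import HarnessLib

/-!
# [IUTchIII] Thm 3.11 (i) (Ind1)+(Ind2) ⟶ Cor 3.12 Step (x), reading (P): the packet–Θ junction with the EXACT residue-degree hypothesis —
# `f(v̲_b|p) ≠ 1` is needed only at RAMIFIED factors `b ≠ j`, and at the twisted factor `b = j` only when `e(v̲_j|p) ∣ ord t`

PROOF-ONLY file (abc-iut cell, Cor. 3.12 sub-crew, seat abc-iut-c312-1 = holder of record of the typed [IUTchIII] Thm. 3.11, gen 16; row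
«R22 = C:SLOT-HULL-UNCONDITIONAL» part (β), C LEAD ruling C-R135 (b)).  TAKES NO SIDE on [IUTchIII] Cor. 3.12.  No definition, no `Prop` fact;
`JannsenWingbergMappingClass` is the only conditional input (binder `hMC`).  STRENGTHENINGS of the seat's R21 theorems (p538494 / p539517) BY NAME —
the R21 files stay as landed; the new theorems carry the WEAKER hypothesis and imply the old ones (`…_of_inertiaDeg_ne_one`).

* §1 packet level **`packetHull_iUnion_image_iota_smul_normalizedPacket_eq_of_residue_of_jannsenWingbergMappingClass`** — R21 file 1's print-side core
  with `hf : ∀ i, f(w_i|p) ≠ 1` replaced by `hres : ∀ i, f(w_i|p) = 1 → (i = i₀ ∧ e_{i₀} ∤ v)`: the single-place floor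
  (`Thm311RealInd1StripHullIdealsFloor`, p533915) excludes only the depth-`n = e` case at residue degree one; off the twisted factor the box balls are the
  unit balls `𝒪 = p⁻¹·𝔪^{e}` (depth `e`), at the twisted factor the depth is `(v − 1) mod e_{i₀} + 1` (`= e_{i₀}` iff `e_{i₀} ∣ v`).  Same proof otherwise
  (box `ι_{i₀}(g)·R_I` of total content `p^{A}`, gen 15's packet floor p535531, container side by the star form);
  `…_of_inertiaDeg_ne_one`: R21's hypothesis implies `hres`.
* §2 place-section level **`localFields_packetHull_orbitH_pilotRegion_eq_slotImagesHull_of_residue_of_jannsenWingbergMappingClass`** — at a collection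
  `v⃗` with every factor tame of odd local degree `≥ 3`: residue degree `≠ 1` is required only at the RAMIFIED factors `b ≠ j` (at unramified factors
  `f = ` local degree `≥ 3` automatically, abc-iut-S7 `absRamificationIdx_rescaledCompletion`) and at `b = j` only when `e(v̲_j|p) ∣ ord t_{i,v_j}`
  (`hlast`); conclusion as in R21: the `(R_I)^∼`-hull of the `H`-orbit of `O_𝕃(−P_Θ)_{v⃗}` equals `slotImagesHull`;
  §3 **`localFields_lnνLp_hull_orbitH_eq_negLogThetaPerImageAt_of_residue_of_jannsenWingbergMappingClass`** — the `ln ν̄_{𝕃_p}`-level identity with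
  `−|log(Θ)|^{(P)}_p` under the per-collection residue hypothesis (a valuation family `v(i,v⃗)` of the Θ-idele displayed).

HONEST SCOPE as in R21: OUR typings (THE equivariant lift, THE logarithm, factorwise action; F-B28-1 untouched); conditional on `hMC`; residues that
REMAIN: ramified `f = 1` factors off the twist, the twisted factor with `f = 1` and `e ∣ ord t` (the depth-`e` bit: valuation of the radial
Jannsen–Wingberg log-generator, un-pinned by the fact), EVEN local degree (NOT typed), WILD, `p = 2`; equal-AS-TYPED ≠ equal in print; nothing here
asserts that abc is proved or refuted; no side taken. [claim: Mochizuki2012, status: disputed]; [cite: Mochizuki2012, IUTchIII Thm. 3.11 (i) p. 154;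
Rmk. 3.9.5 (i) p. 127; Cor. 3.12 Step (x)/(xi) pp. 181–183; IUTchIV Prop. 1.2 (ii) p. 10–11]; [cite: Kondo2025OuterAutMLF, §3 Thm 3.17, Rem 3.18];
[cite: DupuyHilado2025, §4.9, §4.12]. typed ≠ proved; a conditional theorem discharges nothing it binds.
-/

set_option autoImplicit false

noncomputable section

open Metric Set Function
open scoped Pointwise TensorProduct

namespace Summit.ABC.IUTFork.Thm311.Real

open NumberField IsDedekindDomain Literature.NumberTheory.NumberFields Literature.IUT.LogVolume
open Literature.NumberTheory.GaloisRepresentations Literature.NumberTheory.GaloisRepresentations.Ultrametric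
open Literature.AnabelianGeometry.AbsoluteAnabelian Literature.IUT.HodgeArakelov
open Literature.IUT.HodgeArakelov.AbsTopMonoids

/-! ## §1 Packet level: the junction under the exact residue hypothesis -/

section GenuineFactors

variable {K : Type} [Field K] [NumberField K] (p : ℕ) [hp : Fact p.Prime]
variable {I : Type} [Fintype I] [DecidableEq I] (w : I → HeightOneSpectrum (𝓞 K)) (hw : ∀ i, ((p : ℕ) : 𝓞 K) ∈ (w i).asIdeal)

/-- **PRINT SIDE — THE JUNCTION at the packet, EXACT RESIDUE form (modulo `JannsenWingbergMappingClass`).**  Same packet as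
`packetHull_iUnion_image_iota_smul_normalizedPacket_eq_of_jannsenWingbergMappingClass` (file 1), every factor TAME of ODD local degree `≥ 3`,
`‖g‖ = p^{−v/e_{i₀}}`, but the residue-degree hypothesis SHARPENED to exactly what the single-place floors consume: a factor may have `f(w_i|p) = 1`
only if it is the twisted factor `i₀` AND `e_{i₀} ∤ v` (hypothesis `hres`; off `i₀` the factor balls are the unit balls `p⁻¹·𝔪^{e_i}` = depth `e_i`,
at `i₀` the depth is `(v − 1) mod e_{i₀} + 1`, which is `e_{i₀}` iff `e_{i₀} ∣ v`).  For every subgroup `H` of `Aut_{ℚ_p}(X)` INSIDE the container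
(`H ≤ indTwo`) and CONTAINING the single-factor strip moves `⊗ z ↦ ⊗ z[i₁ ↦ ψ z_{i₁}]`, `ψ ∈ Real.ind1StripOf w_{i₁} (galoisLog w_{i₁})`
(print's (Ind1) strip part at one factor, the others fixed): the `(R_I)^∼`-hull of the `H`-orbit of the twist `ι_{i₀}(g)·(R_I)^∼` IS
`packetHull(p^{A}·log_p(R_I^×))`, `A = (v − 1) div e_{i₀} + 1 − |I|`.  Container side: the previous lemma; print side: the pure tensors of the
BOX `ι_{i₀}(g)·R_I` (`‖a_i‖ ≤ 1` off `i₀`, `‖a_{i₀}‖ ≤ ‖g‖`) are the products of the factor balls `p⁻¹·𝔪^{e_i}` (`i ≠ i₀`) and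
`p^{(v−1) div e}·𝔪^{(v−1) mod e + 1}` (`i = i₀`), of total content `p^{A}`, and gen 15's packet floor
`packetHull_eq_of_balls_of_jannsenWingbergMappingClass` applies to the additive span of the `H`-orbit. [claim: Mochizuki2012, status: disputed]
[cite: Mochizuki2012, IUTchIII Thm. 3.11 (i) p. 154; Rmk. 3.9.5 (i) p. 127; Cor. 3.12 Step (xi) p. 183; IUTchIV Prop. 1.2 (ii) p. 10–11]
[cite: Kondo2025OuterAutMLF, §3 Thm 3.17, Rem 3.18] [cite: DupuyHilado2025, §4.9, §4.12] -/
theorem packetHull_iUnion_image_iota_smul_normalizedPacket_eq_of_residue_of_jannsenWingbergMappingClass [Nonempty I]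
    (hMC : JannsenWingbergMappingClass) (hp2 : 2 < p)
    (he : ∀ i, absRamificationIdx p (RescaledCompletion K p (w i) (hw i)) ≤ p - 2)
    (h3 : ∀ i, 3 ≤ localDeg K (w i)) (hodd : ∀ i, Odd (localDeg K (w i)))
    (i₀ : I) {g : RescaledCompletion K p (w i₀) (hw i₀)} {v : ℤ}
    (hv : ‖g‖ = (p : ℝ) ^ (-(v / (absRamificationIdx p (RescaledCompletion K p (w i₀) (hw i₀)) : ℝ))))
    (hres : ∀ i, (w i).asIdeal.inertiaDeg ℤ = 1 →
      i = i₀ ∧ ¬ ((absRamificationIdx p (RescaledCompletion K p (w i₀) (hw i₀)) : ℤ) ∣ v))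
    (H : Subgroup (PacketAlgebra p (fun i => RescaledCompletion K p (w i) (hw i)) ≃ₗ[ℚ_[p]]
      PacketAlgebra p (fun i => RescaledCompletion K p (w i) (hw i))))
    (hH : H ≤ indTwo p (fun i => RescaledCompletion K p (w i) (hw i)))
    (hstrip : ∀ (i₁ : I), ∀ ψ ∈ ind1StripOf (w i₁) (galoisLog (w i₁)), ∃ γ ∈ H,
      ∀ z : Π i, RescaledCompletion K p (w i) (hw i),
        (γ : PacketAlgebra p (fun i => RescaledCompletion K p (w i) (hw i)) ≃ₗ[ℚ_[p]]
            PacketAlgebra p (fun i => RescaledCompletion K p (w i) (hw i))) (PiTensorProduct.tprod ℚ_[p] z) =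
          PiTensorProduct.tprod ℚ_[p] (update z i₁ (RescaledCompletion.of K p (w i₁) (hw i₁)
            (ψ ((RescaledCompletion.of K p (w i₁) (hw i₁)).symm (z i₁)))))) :
    packetHull p (fun i => RescaledCompletion K p (w i) (hw i))
        (⋃ γ : H, (γ : PacketAlgebra p (fun i => RescaledCompletion K p (w i) (hw i)) ≃ₗ[ℚ_[p]]
            PacketAlgebra p (fun i => RescaledCompletion K p (w i) (hw i))) ''
          (iota p (fun i => RescaledCompletion K p (w i) (hw i)) i₀ g •
            (normalizedPacket p (fun i => RescaledCompletion K p (w i) (hw i)) :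
              Set (PacketAlgebra p (fun i => RescaledCompletion K p (w i) (hw i)))))) =
      packetHull p (fun i => RescaledCompletion K p (w i) (hw i))
        (((p : ℚ_[p]) ^ ((v - 1) / (absRamificationIdx p (RescaledCompletion K p (w i₀) (hw i₀)) : ℤ) + 1 - Fintype.card I)) •
          (logPacket p (fun i => RescaledCompletion K p (w i) (hw i)) :
            Set (PacketAlgebra p (fun i => RescaledCompletion K p (w i) (hw i))))) := by
  classical
  set k := fun i => RescaledCompletion K p (w i) (hw i) with hk
  set e := fun i => RescaledCompletion.of K p (w i) (hw i) with he_def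
  set E : ℕ := absRamificationIdx p (k i₀) with hE
  set A : ℤ := (v - 1) / (E : ℤ) + 1 - Fintype.card I with hA
  set L : Set (PacketAlgebra p k) := (logPacket p k : Set (PacketAlgebra p k)) with hL
  set M : Set (PacketAlgebra p k) := iota p k i₀ g • (normalizedPacket p k : Set (PacketAlgebra p k)) with hM
  set O : Set (PacketAlgebra p k) := ⋃ γ : H, (γ : PacketAlgebra p k ≃ₗ[ℚ_[p]] PacketAlgebra p k) '' M with hO
  set N : AddSubgroup (PacketAlgebra p k) := AddSubgroup.closure O with hN
  have hP : p.Prime := Fact.out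
  have hp0 : (0 : ℝ) < p := by exact_mod_cast hP.pos
  have hpQ : (p : ℚ_[p]) ≠ 0 := by exact_mod_cast hP.ne_zero
  have hE0 : 0 < E := absRamificationIdx_pos p (k i₀)
  have hE0z : (0 : ℤ) < (E : ℤ) := by exact_mod_cast hE0
  have hg0 : g ≠ 0 := norm_pos_iff.mp (by rw [hv]; positivity)
  -- container side: `M ⊆ p^A·L`, hence `O ⊆ p^A·L` and `N ⊆ p^A·L ⊆ packetHull(p^A·L)`
  obtain ⟨hMA, hOA'⟩ := packetHull_iUnion_image_iota_smul_normalizedPacket_subset_of_tame p w hw hp2 he i₀ hv H hH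
  have hOA : O ⊆ ((p : ℚ_[p]) ^ A) • L := by
    refine Set.iUnion_subset fun γ => ?_
    calc (γ : PacketAlgebra p k ≃ₗ[ℚ_[p]] PacketAlgebra p k) '' M
        ⊆ (γ : PacketAlgebra p k ≃ₗ[ℚ_[p]] PacketAlgebra p k) '' (((p : ℚ_[p]) ^ A) • L) := Set.image_mono hMA
      _ = ((p : ℚ_[p]) ^ A) • L := image_const_smul_logPacket_of_mem_indTwo p k (hH γ.2) _
  have hNA : (N : Set (PacketAlgebra p k)) ⊆ ((p : ℚ_[p]) ^ A) • L := by
    have h : N ≤ ((p : ℚ_[p]) ^ A) • logPacket p k :=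
      (AddSubgroup.closure_le _).mpr (by rw [AddSubgroup.coe_pointwise_smul]; exact hOA)
    intro x hx
    have hx' : x ∈ ((p : ℚ_[p]) ^ A) • logPacket p k := h hx
    rwa [← SetLike.mem_coe, AddSubgroup.coe_pointwise_smul] at hx'
  -- the box data: depth `n = (v−1) mod e + 1` and content `p^{(v−1) div e}` at `i₀`, `p⁻¹·𝔪^{e_i}` elsewhere
  set a : ℤ := (v - 1) / (E : ℤ) with ha
  set r : ℤ := (v - 1) % (E : ℤ) with hr
  have hr0 : 0 ≤ r := Int.emod_nonneg _ hE0z.ne'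
  have hrE : r < E := Int.emod_lt_of_pos _ hE0z
  have hvar : v - 1 = (E : ℤ) * a + r := by rw [hr, Int.emod_def]; ring
  set n : ℕ := r.toNat + 1 with hn
  have hnr : (n : ℤ) = r + 1 := by rw [hn, Nat.cast_add, Nat.cast_one, Int.toNat_of_nonneg hr0]
  have hn1 : 1 ≤ n := Nat.le_add_left 1 _
  have hnE : n ≤ E := by omega
  have hvR : (v : ℝ) = (E : ℝ) * a + n := by
    have h1 : v = (E : ℤ) * a + n := by rw [hnr]; omega
    exact_mod_cast h1
  let cc : I → ℚ_[p] := fun i => if i = i₀ then (p : ℚ_[p]) ^ a else (p : ℚ_[p])⁻¹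
  let nn : I → ℕ := fun i => if i = i₀ then n else absRamificationIdx p (k i)
  have hcc0 : ∀ i, cc i ≠ 0 := by
    intro i; by_cases hi : i = i₀
    · simp only [cc, if_pos hi]; exact zpow_ne_zero _ hpQ
    · simp only [cc, if_neg hi]; exact inv_ne_zero hpQ
  have hnn1 : ∀ i, 1 ≤ nn i := by
    intro i; by_cases hi : i = i₀
    · simp only [nn, if_pos hi]; exact hn1
    · simp only [nn, if_neg hi]; exact absRamificationIdx_pos p (k i)
  have hnne : ∀ i, nn i ≤ absRamificationIdx p (k i) := by
    intro i; by_cases hi : i = i₀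
    · subst hi; simp only [nn, if_pos rfl]; exact hnE
    · simp only [nn, if_neg hi]; exact le_rfl
  have hexc : ∀ i, ¬ (nn i = absRamificationIdx p (k i) ∧ (w i).asIdeal.inertiaDeg ℤ = 1) := by
    rintro i ⟨hni, hfi⟩
    obtain ⟨rfl, hndvd⟩ := hres i hfi
    simp only [nn, if_pos rfl] at hni
    refine hndvd ⟨a + 1, ?_⟩
    have hnE' : (n : ℤ) = E := by exact_mod_cast hni
    have : v = (E : ℤ) * a + r + 1 := by rw [hr, ha, Int.emod_def]; ring
    rw [hnr] at hnE'
    linarith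
  -- radii of the box: `‖g‖` at `i₀`, `1` elsewhere
  have hrad₀ : ‖cc i₀‖ * (p : ℝ) ^ (-((nn i₀ : ℝ) / (absRamificationIdx p (k i₀) : ℝ))) = ‖g‖ := by
    simp only [cc, nn, if_pos rfl]
    rw [hv, norm_zpow, Padic.norm_p, inv_zpow', ← Real.rpow_intCast, ← Real.rpow_add hp0]
    congr 1
    have hE0r : (E : ℝ) ≠ 0 := by exact_mod_cast hE0.ne'
    rw [show (absRamificationIdx p (RescaledCompletion K p (w i₀) (hw i₀)) : ℝ) = E from rfl, hvR]
    push_cast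
    field_simp
    ring
  have hrad : ∀ i, i ≠ i₀ → ‖cc i‖ * (p : ℝ) ^ (-((nn i : ℝ) / (absRamificationIdx p (k i) : ℝ))) = 1 := by
    intro i hi
    simp only [cc, nn, if_neg hi]
    have hEi : (absRamificationIdx p (k i) : ℝ) ≠ 0 := by exact_mod_cast (absRamificationIdx_pos p (k i)).ne'
    rw [norm_inv, Padic.norm_p, inv_inv, div_self hEi, Real.rpow_neg_one, mul_inv_cancel₀ hp0.ne']
  -- the pure tensors of the box lie in `M ⊆ O ⊆ N`
  have hMO : M ⊆ O := by
    intro x hx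
    refine Set.mem_iUnion.mpr ⟨(1 : H), ?_⟩
    rw [OneMemClass.coe_one, LinearEquiv.coe_one, Set.image_id]
    exact hx
  have hbox : ∀ x : Π i, (w i).adicCompletion K,
      (∀ i, ‖e i (x i)‖ ≤ ‖cc i‖ * (p : ℝ) ^ (-((nn i : ℝ) / (absRamificationIdx p (k i) : ℝ)))) →
      PiTensorProduct.tprod ℚ_[p] (fun i => e i (x i)) ∈ N := by
    intro x hx
    refine AddSubgroup.subset_closure (hMO ?_)
    -- `⊗ x = ι_{i₀}(g)·⊗ y`, `y = x[i₀ ↦ g⁻¹ x_{i₀}]`, `y` integral in every factor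
    let y : Π i, k i := update (fun i => e i (x i)) i₀ (g⁻¹ * e i₀ (x i₀))
    have hy1 : ∀ i, ‖y i‖ ≤ 1 := by
      intro i; by_cases hi : i = i₀
      · subst hi
        simp only [y, update_self]
        rw [norm_mul, norm_inv, inv_mul_le_iff₀ (norm_pos_iff.mpr hg0), mul_one, ← hrad₀]
        exact hx _
      · simp only [y, update_of_ne hi]
        rw [← hrad i hi]; exact hx i
    refine ⟨purePacket p k y, integerPacket_le_normalizedPacket p k (purePacket_mem_integerPacket p k hy1), ?_⟩
    show iota p k i₀ g * purePacket p k y = PiTensorProduct.tprod ℚ_[p] (fun i => e i (x i))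
    rw [iota_mul_purePacket]
    simp only [y, update_self, update_idem, mul_inv_cancel_left₀ hg0, update_eq_self]
    rfl
  -- `N` is stable under the single-factor strip moves (realised in `H`; the span of the `H`-orbit is `H`-stable)
  have hNstrip : ∀ (i₁ : I), ∀ ψ ∈ ind1StripOf (w i₁) (galoisLog (w i₁)), ∀ z : Π i, k i,
      PiTensorProduct.tprod ℚ_[p] z ∈ N →
        PiTensorProduct.tprod ℚ_[p] (update z i₁ (e i₁ (ψ ((e i₁).symm (z i₁))))) ∈ N := by
    intro i₁ ψ hψ z hz
    obtain ⟨γ₀, hγ₀H, hγ₀⟩ := hstrip i₁ ψ hψ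
    have h := map_closure_iUnion_image_le p k M H hγ₀H ⟨_, hz, rfl⟩
    change γ₀ (PiTensorProduct.tprod ℚ_[p] z) ∈ N at h
    rwa [hγ₀ z] at h
  -- the total content of the box is `p^A`
  have hprod : ∏ i, cc i = (p : ℚ_[p]) ^ A := by
    rw [← Finset.mul_prod_erase Finset.univ cc (Finset.mem_univ i₀)]
    have h1 : ∏ i ∈ Finset.univ.erase i₀, cc i = ((p : ℚ_[p])⁻¹) ^ (Fintype.card I - 1) := by
      rw [Finset.prod_congr rfl (fun i hi => show cc i = (p : ℚ_[p])⁻¹ by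
        simp only [cc, if_neg (Finset.ne_of_mem_erase hi)]), Finset.prod_const,
        Finset.card_erase_of_mem (Finset.mem_univ _), Finset.card_univ]
    rw [h1]
    simp only [cc, if_pos rfl]
    rw [inv_pow, ← zpow_natCast, ← zpow_neg, ← zpow_add₀ hpQ]
    congr 1
    have hI : 1 ≤ Fintype.card I := Fintype.card_pos
    rw [hA, ha, Nat.cast_sub hI]
    push_cast
    ring
  -- the packet floor on `N`
  have hNc : (N : Set (PacketAlgebra p k)) ⊆ packetHull p k ((∏ i, cc i) • L) := by
    rw [hprod]; exact hNA.trans (subset_packetHull p k _)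
  have hfloor := packetHull_eq_of_balls_of_jannsenWingbergMappingClass p w hw hMC hp2 he h3 hodd cc hcc0 nn hnn1 hnne
    hexc N hbox hNstrip hNc
  rw [hprod] at hfloor
  rw [← packetHull_coe_closure_eq p k O]
  exact hfloor

omit [Fintype I] [DecidableEq I] in
/-- R21's residue hypothesis `∀ i, f(w_i|p) ≠ 1` implies the exact one (trivially); so the `_of_residue_` theorem STRENGTHENS R21 file 1's
`packetHull_iUnion_image_iota_smul_normalizedPacket_eq_of_jannsenWingbergMappingClass` (p538494). [cite: Mochizuki2012, IUTchIII Thm. 3.11 (i) p. 154] -/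
theorem residue_of_inertiaDeg_ne_one (hf : ∀ i, (w i).asIdeal.inertiaDeg ℤ ≠ 1) (i₀ : I) (v : ℤ) :
    ∀ i, (w i).asIdeal.inertiaDeg ℤ = 1 →
      i = i₀ ∧ ¬ ((absRamificationIdx p (RescaledCompletion K p (w i₀) (hw i₀)) : ℤ) ∣ v) :=
  fun i hi => absurd hi (hf i)

omit [Fintype I] [DecidableEq I] in
/-- **At an UNRAMIFIED factor of local degree `≥ 3` the residue degree is automatically `≠ 1`** (`f = e·f = [K_w : ℚ_p] ≥ 3`; abc-iut-S7
`absRamificationIdx_rescaledCompletion`). [cite: NeukirchANT1999, Ch. II Prop. (6.8)] -/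
theorem inertiaDeg_ne_one_of_absRamificationIdx_eq_one (i : I) (h3 : 3 ≤ localDeg K (w i))
    (he1 : absRamificationIdx p (RescaledCompletion K p (w i) (hw i)) = 1) : (w i).asIdeal.inertiaDeg ℤ ≠ 1 := by
  intro hf
  rw [absRamificationIdx_rescaledCompletion] at he1
  unfold localDeg at h3
  rw [he1, hf] at h3
  omega

omit [Fintype I] [DecidableEq I] in
/-- The sharpened residue hypothesis («`f ≠ 1` only at RAMIFIED factors off `i₀`; at `i₀` only when `e_{i₀} ∣ v`») implies `hres` at factors of local
degree `≥ 3`. [cite: Mochizuki2012, IUTchIII Thm. 3.11 (i) p. 154] -/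
theorem residue_of_ramified (h3 : ∀ i, 3 ≤ localDeg K (w i)) (i₀ : I) (v : ℤ)
    (hram : ∀ i, i ≠ i₀ → absRamificationIdx p (RescaledCompletion K p (w i) (hw i)) ≠ 1 → (w i).asIdeal.inertiaDeg ℤ ≠ 1)
    (hlast : (w i₀).asIdeal.inertiaDeg ℤ = 1 → ¬ ((absRamificationIdx p (RescaledCompletion K p (w i₀) (hw i₀)) : ℤ) ∣ v)) :
    ∀ i, (w i).asIdeal.inertiaDeg ℤ = 1 →
      i = i₀ ∧ ¬ ((absRamificationIdx p (RescaledCompletion K p (w i₀) (hw i₀)) : ℤ) ∣ v) := by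
  intro i hfi
  by_cases hi : i = i₀
  · subst hi; exact ⟨rfl, hlast hfi⟩
  · exfalso
    by_cases he1 : absRamificationIdx p (RescaledCompletion K p (w i) (hw i)) = 1
    · exact inertiaDeg_ne_one_of_absRamificationIdx_eq_one p w hw i (h3 i) he1 hfi
    · exact hram i hi he1 hfi

end GenuineFactors

/-! ## §2 Place-section level: the junction under the exact residue hypothesis -/

section PlaceSection

variable {F₀ : Type} [Field F₀] [NumberField F₀] {K : Type} [Field K] [NumberField K] [Algebra F₀ K]
variable (σ : PlaceSection F₀ K) (p : ℕ) [hp : Fact p.Prime]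
variable (c : (j : ℕ) → (Fin (j + 1) → placesOver F₀ p) → ℚ_[p]) (hc0 : ∀ j e, c j e ≠ 0)
  (hcσ : ∀ (j : ℕ) (τ : Equiv.Perm (Fin (j + 1))) (e : Fin (j + 1) → placesOver F₀ p), c j (e ∘ τ) = c j e)

/-- **THE PACKET–THETA JUNCTION with the EXACT residue hypothesis (modulo `JannsenWingbergMappingClass`).**  Setting of R21's
`localFields_packetHull_orbitH_pilotRegion_eq_slotImagesHull_of_jannsenWingbergMappingClass` (every factor of `v⃗` tame of odd local degree `≥ 3`,
`H ≤ indTwo` containing the single-factor (Ind1) strip moves), with `‖t_{i,v_j}‖ = p^{−v/e(v̲_j|p)}` displayed and the residue hypothesis weakened to: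
residue degree `≠ 1` at the RAMIFIED factors `b ≠ j` (`hram`), and at the twisted factor `b = j` only when `e(v̲_j|p) ∣ v` (`hlast`).  Conclusion
unchanged: the `(R_I)^∼`-hull of the `H`-orbit of `O_𝕃(−P_Θ)_{v⃗}` equals `slotImagesHull`. [claim: Mochizuki2012, status: disputed]
[cite: Mochizuki2012, IUTchIII Thm. 3.11 (i) p. 154; Cor. 3.12 Step (x)/(xi) pp. 181–183] [cite: Kondo2025OuterAutMLF, §3 Thm 3.17, Rem 3.18]
[cite: DupuyHilado2025, §4.9, §4.12] -/
theorem localFields_packetHull_orbitH_pilotRegion_eq_slotImagesHull_of_residue_of_jannsenWingbergMappingClass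
    (hMC : JannsenWingbergMappingClass) (hp2 : 2 < p) {lstar : ℕ}
    (t : Fin lstar → (v : placesOver F₀ p) → ((σ.localFields p).k v)ˣ) (i : Fin lstar)
    (e : Fin ((i : ℕ) + 1 + 1) → placesOver F₀ p)
    (he : ∀ b, absRamificationIdx p ((σ.localFields p).k (e b)) ≤ p - 2)
    (h3 : ∀ b, 3 ≤ localDeg K (σ.lift (e b).1)) (hodd : ∀ b, Odd (localDeg K (σ.lift (e b).1)))
    {v : ℤ} (hv : ‖(t i (e (Fin.last _)) : (σ.localFields p).k (e (Fin.last _)))‖ =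
      (p : ℝ) ^ (-(v / (absRamificationIdx p ((σ.localFields p).k (e (Fin.last _))) : ℝ))))
    (hram : ∀ b, b ≠ Fin.last _ → absRamificationIdx p ((σ.localFields p).k (e b)) ≠ 1 → (σ.lift (e b).1).asIdeal.inertiaDeg ℤ ≠ 1)
    (hlast : (σ.lift (e (Fin.last _)).1).asIdeal.inertiaDeg ℤ = 1 →
      ¬ ((absRamificationIdx p ((σ.localFields p).k (e (Fin.last _))) : ℤ) ∣ v))
    (H : Subgroup (PacketAlgebra p (fun b => (σ.localFields p).k (e b)) ≃ₗ[ℚ_[p]]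
      PacketAlgebra p (fun b => (σ.localFields p).k (e b))))
    (hH : H ≤ indTwo p (fun b => (σ.localFields p).k (e b)))
    (hstrip : ∀ (b₀ : Fin ((i : ℕ) + 1 + 1)),
      ∀ ψ ∈ ind1StripOf (σ.lift (e b₀).1) (galoisLog (σ.lift (e b₀).1)), ∃ γ ∈ H,
        ∀ z : ∀ b, (σ.localFields p).k (e b),
          (γ : PacketAlgebra p (fun b => (σ.localFields p).k (e b)) ≃ₗ[ℚ_[p]]
              PacketAlgebra p (fun b => (σ.localFields p).k (e b))) (PiTensorProduct.tprod ℚ_[p] z) =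
            PiTensorProduct.tprod ℚ_[p] (update z b₀
              (RescaledCompletion.of K p (σ.lift (e b₀).1) (σ.natCast_mem_lift (e b₀))
                (ψ ((RescaledCompletion.of K p (σ.lift (e b₀).1) (σ.natCast_mem_lift (e b₀))).symm (z b₀)))))) :
    packetHull p (fun b => (σ.localFields p).k (e b))
        (⋃ γ : H, (γ : PacketAlgebra p (fun b => (σ.localFields p).k (e b)) ≃ₗ[ℚ_[p]]
            PacketAlgebra p (fun b => (σ.localFields p).k (e b))) ''
          (realPrimePacketWith p (σ.localFields p) c hc0 hcσ).pilotRegion t ((i : ℕ) + 1) e) =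
      (realPrimePacketWith p (σ.localFields p) c hc0 hcσ).slotImagesHull
        ((realPrimePacketWith p (σ.localFields p) c hc0 hcσ).pilotRegion t) ((i : ℕ) + 1) e := by
  have hres := residue_of_ramified p (fun b => σ.lift (e b).1) (fun b => σ.natCast_mem_lift (e b)) h3 (Fin.last _) v hram hlast
  have hcore := packetHull_iUnion_image_iota_smul_normalizedPacket_eq_of_residue_of_jannsenWingbergMappingClass p
    (fun b => σ.lift (e b).1) (fun b => σ.natCast_mem_lift (e b)) hMC hp2 he h3 hodd (Fin.last _) hv hres H hH hstrip
  obtain ⟨-, hcont⟩ := packetHull_iUnion_image_iota_smul_normalizedPacket_subset_of_tame p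
    (fun b => σ.lift (e b).1) (fun b => σ.natCast_mem_lift (e b)) hp2 he (Fin.last _) hv
    (indTwo p (fun b => (σ.localFields p).k (e b))) le_rfl
  refine Set.Subset.antisymm ?_ ?_
  · exact packetHull_mono p _
      (realPrimePacketWith_orbitH_subset_slotImages p (σ.localFields p) c hc0 hcσ t i e H hH)
  · change packetHull p _ ((realPrimePacketWith p (σ.localFields p) c hc0 hcσ).slotImages _ _ e) ⊆ _
    rw [realPrimePacketWith_slotImages_pilotRegion_eq,
      Set.iUnion_congr (fun γ => indTwo_smul_set p (fun b => (σ.localFields p).k (e b)) γ _),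
      realPrimePacketWith_pilotRegion_succ_eq]
    refine hcont.trans (le_of_eq ?_)
    exact hcore.symm

/-! ## §3 The `ln ν̄_{𝕃_p}`-level identity under the exact residue hypothesis -/

/-- **READING (P) OVER PRINT's (Ind1)⊔(Ind2) AS TYPED EQUALS `−|log(Θ)|^{(P)}_p`, exact residue form (modulo `JannsenWingbergMappingClass`).**
Every `v̲ ∣ p` of the section tame of odd local degree `≥ 3`; a valuation family `v(i,v⃗)` of the Θ-idele at the last slots; residue degree `≠ 1`
required only at RAMIFIED places (`hram`) except that the twisted factor `v̲_j` of a collection may have `f = 1` when `e(v̲_j|p) ∤ v(i,v⃗)` — stated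
per collection: `hres`.  Then for any family `H` with `H ≤ indTwo` containing the single-factor strip moves:
`ln ν̄_{𝕃_p}(v⃗ ↦ hull(⋃_{g ∈ H_{v⃗}} g(O_𝕃(−P_Θ)_{v⃗}))) = −|log(Θ)|^{(P)}_p`. [claim: Mochizuki2012, status: disputed]
[cite: Mochizuki2012, IUTchIII Thm. 3.11 (i) p. 154; Cor. 3.12 proof Step (x) p. 181] [cite: DupuyHilado2025, §4.9, §4.12] -/
theorem localFields_lnνLp_hull_orbitH_eq_negLogThetaPerImageAt_of_residue_of_jannsenWingbergMappingClass
    (hMC : JannsenWingbergMappingClass) (hp2 : 2 < p) {lstar : ℕ}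
    (t : Fin lstar → (v : placesOver F₀ p) → ((σ.localFields p).k v)ˣ)
    (he : ∀ v : placesOver F₀ p, absRamificationIdx p ((σ.localFields p).k v) ≤ p - 2)
    (h3 : ∀ v : placesOver F₀ p, 3 ≤ localDeg K (σ.lift v.1)) (hodd : ∀ v : placesOver F₀ p, Odd (localDeg K (σ.lift v.1)))
    (v : (i : Fin lstar) → (Fin ((i : ℕ) + 1 + 1) → placesOver F₀ p) → ℤ)
    (hv : ∀ (i : Fin lstar) (e : Fin ((i : ℕ) + 1 + 1) → placesOver F₀ p),
      ‖(t i (e (Fin.last _)) : (σ.localFields p).k (e (Fin.last _)))‖ =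
        (p : ℝ) ^ (-(v i e / (absRamificationIdx p ((σ.localFields p).k (e (Fin.last _))) : ℝ))))
    (hres : ∀ (i : Fin lstar) (e : Fin ((i : ℕ) + 1 + 1) → placesOver F₀ p) (b : Fin ((i : ℕ) + 1 + 1)),
      (σ.lift (e b).1).asIdeal.inertiaDeg ℤ = 1 →
        b = Fin.last _ ∧ ¬ ((absRamificationIdx p ((σ.localFields p).k (e (Fin.last _))) : ℤ) ∣ v i e))
    (H : (j : ℕ) → (e : Fin (j + 1) → placesOver F₀ p) →
      Subgroup (PacketAlgebra p (fun b => (σ.localFields p).k (e b)) ≃ₗ[ℚ_[p]]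
        PacketAlgebra p (fun b => (σ.localFields p).k (e b))))
    (hH : ∀ j e, H j e ≤ indTwo p (fun b => (σ.localFields p).k (e b)))
    (hstrip : ∀ (i : Fin lstar) (e : Fin ((i : ℕ) + 1 + 1) → placesOver F₀ p) (b₀ : Fin ((i : ℕ) + 1 + 1)),
      ∀ ψ ∈ ind1StripOf (σ.lift (e b₀).1) (galoisLog (σ.lift (e b₀).1)), ∃ γ ∈ H ((i : ℕ) + 1) e,
        ∀ z : ∀ b, (σ.localFields p).k (e b),
          (γ : PacketAlgebra p (fun b => (σ.localFields p).k (e b)) ≃ₗ[ℚ_[p]]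
              PacketAlgebra p (fun b => (σ.localFields p).k (e b))) (PiTensorProduct.tprod ℚ_[p] z) =
            PiTensorProduct.tprod ℚ_[p] (update z b₀
              (RescaledCompletion.of K p (σ.lift (e b₀).1) (σ.natCast_mem_lift (e b₀))
                (ψ ((RescaledCompletion.of K p (σ.lift (e b₀).1) (σ.natCast_mem_lift (e b₀))).symm (z b₀)))))) :
    (realPrimePacketWith p (σ.localFields p) c hc0 hcσ).lnνLp lstar (fun j e =>
        packetHull p (fun b => (σ.localFields p).k (e b))
          (⋃ g : H j e, (g : PacketAlgebra p (fun b => (σ.localFields p).k (e b)) ≃ₗ[ℚ_[p]]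
              PacketAlgebra p (fun b => (σ.localFields p).k (e b))) ''
            (realPrimePacketWith p (σ.localFields p) c hc0 hcσ).pilotRegion t j e)) =
      (realPrimePacketWith p (σ.localFields p) c hc0 hcσ).negLogThetaPerImageAt lstar t := by
  refine realPrimePacketWith_lnνLp_hull_orbitH_eq_negLogThetaPerImageAt_of_forall_eq p (σ.localFields p) c hc0 hcσ t H fun i e => ?_
  have hcore := packetHull_iUnion_image_iota_smul_normalizedPacket_eq_of_residue_of_jannsenWingbergMappingClass p
    (fun b => σ.lift (e b).1) (fun b => σ.natCast_mem_lift (e b)) hMC hp2 (fun b => he (e b)) (fun b => h3 (e b))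
    (fun b => hodd (e b)) (Fin.last _) (hv i e) (hres i e) (H _ e) (hH _ e) (hstrip i e)
  obtain ⟨-, hcont⟩ := packetHull_iUnion_image_iota_smul_normalizedPacket_subset_of_tame p
    (fun b => σ.lift (e b).1) (fun b => σ.natCast_mem_lift (e b)) hp2 (fun b => he (e b)) (Fin.last _) (hv i e)
    (indTwo p (fun b => (σ.localFields p).k (e b))) le_rfl
  refine Set.Subset.antisymm ?_ ?_
  · exact packetHull_mono p _
      (realPrimePacketWith_orbitH_subset_slotImages p (σ.localFields p) c hc0 hcσ t i e (H _ e) (hH _ e))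
  · rw [realPrimePacketWith_slotImages_pilotRegion_eq,
      Set.iUnion_congr (fun γ => indTwo_smul_set p (fun b => (σ.localFields p).k (e b)) γ _),
      realPrimePacketWith_pilotRegion_succ_eq]
    refine hcont.trans (le_of_eq ?_)
    exact hcore.symm

end PlaceSection

end Summit.ABC.IUTFork.Thm311.Real

end
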